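import Summits.QuantumFields.YangMills.Theorems.BalabanUVNodesN21ExpChartSharpRadius

/-!
# N21 (NE7c) · THE SHARP RADIUS `√2·π` OF THE `SU(N)` EXPONENTIAL CHART, II: (CH)₁ `Haar ⌞ exp B̄_S = exp_*(vol ⌞ B̄_S · κ_N J)`,
# pub-balaban's realized `SU(N)` (M1) engine, and file 18's properness `Haar(exp B̄_S) < 1` hold for EVERY window radius
# `S < √2·π` and every `N` (tree: `S ≤ π`; `S < √2·π` only at `N = 2` via quaternions)

Width seat pub-ymgap-dag-n21-w1 (g4; director-ym №197 ∕ HUMAN RULING D-0149), node N21 = NE7c (NOT PRINTED in [Bałaban 1983–89], NOT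
proved), lane K3⁸ `SpineGivenEndpointR13SepCoPHV` (stmt-QuantumFields-27366, KEY MAP v2; lineage K3⁷ stmt-QuantumFields-20544),
`--kind proof --supports … --as helper`.  File 24 of the seat's chain.  THEOREMS ONLY: 0 `def`, 0 `sorry`; count-neutral.  Imports file 23
`…N21ExpChartSharpRadius` (§1 gaps, §4 injectivity `expPtSU_injOn_of_lt_sqrt_two_mul_pi` ∕ `injOn_expM_of_lt` ∕ ★
`exists_real_eigen_of_exp_eq_conjDiag`, §5 `injective_fderiv_expM_of_norm_lt`; hence files 18 ∕ 19 and pub-balaban's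
`ShellMeasureExpHaarClosedBallSUN` ∕ `…ExpHaarAreaSUN` ∕ `…ExpJacobianSUN` ∕ `…ScalingSUN` ∕ `…RealizedSUN` ∕ `…HaarHausdorffSUN`).  NO Theses
import.  Restates nothing; cites by name.

WHY.  pub-balaban's (CH)₁ line — STEP 1 (Duhamel derivative) + STEP 2 (`det T_v = ∏ sinc²`) + the area formula on the Hilbert–Schmidt
Hausdorff measure + Haar = normalised Hausdorff — takes exactly two radius-dependent inputs: injectivity of the chart on the window and
injectivity of its differential; the realized (M1) engine takes one more, the centre-monotonicity `hJ₁c` of the Jacobian `∏ sinc²((θ_j−θ_i)/2)`,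
which needs the gaps `|θ_j − θ_i| ≤ 2π` (`sinc²` decreases on `[0, π]`).  File 23 supplies all three on the ball of radius `√2·π` (gaps from
`Σθ² ≤ 2π²`, injectivity from the trace), so the assembly re-runs VERBATIM with `S < √2·π` in place of `S ≤ π`.  File 18's properness witness
`diag(−1, −1, 1, …, 1)` also survives to `S < √2·π`: by file 23's ★ a preimage `v` would have `H(v)` diagonal with two real angles of modulus
`≥ π`, so `‖v‖² ≥ 2π²`.  At `S = √2·π` all three fail together (`θ = (π, −π, 0, …)`: two preimages, `sinc π = 0`, the witness IS
`exp` of it), and at `N = 2` the closed `√2·π`-window is all of `SU(2)`.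

WHAT IS PROVED ([folklore]; pub-balaban modules and files 18 ∕ 19 ∕ 23 credited by name).
* §6 `map_expM_withDensity_jacM_of_lt`, `map_expPtSU_withDensity_jacM_of_lt`, ★★ (CH)₁ `haar_restrict_expBallSU_of_lt` (`S < √2·π`, `N ≥ 1`) —
  pub-balaban's binder `hCH` token-for-token with `κ := kappaSU N`.
* §7 `expJacSU_le_smul_of_norm_le` (‖v‖ ≤ √2·π), `expJacWeightSU_le_smul_of_le` (= the binder `hJ₁c` for `S ≤ √2·π`).
* §8 ★★ `slotAntiConcentration_realized_suN_of_lt` — the realized `SU(N)` (M1) engine on the window range `0 ≤ S < √2·π`, every other binder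
  verbatim.
* §9 `pi_le_abs_of_cexp_mul_I_eq_neg_one`, `conjDiag_one_left`; ★ `exists_not_mem_expBallSU_of_lt` (`diag(−1,−1,1,…) ∉ exp B̄_S`, `S < √2·π`,
  `N ≥ 2`), `exists_not_mem_expWindowSU_of_lt`, `haar_compl_expBallSU_pos_of_lt`, ★ `haar_expBallSU_lt_one_of_lt`, ★ `haar_expWindowSU_lt_one_of_lt`,
  `haar_compl_expWindowSU_pos_of_lt` — file 18's properness on the full range.
* §10 A2 `exists_expPtSU_eq_of_rank_two` (every `U ∈ SU(2)` is `expPtSU v`, `‖v‖ ≤ √2·π`), `expBallSU_rank_two_sqrt_two_mul_pi_eq_univ`,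
  `haar_expBallSU_rank_two_sqrt_two_mul_pi` (mass `1`): §9's range is sharp at `N = 2`.

HONEST FRAMING.  [folklore] classical Lie-group measure theory BY NAME over pub-balaban's modules; no located letter of any N21 road is touched; types
nothing of Bałaban's; (M1) ∕ NE7c NOT PRINTED ∕ NOT proved; **N21 NOT discharged**; K3⁸ NOT claimed; counts unmoved (typed 28∕28 · discharged 5∕27);
never a count claim; one finite 𝕋⁴ at fixed ε — R4 would close only the conditional finite-𝕋⁴ rung `BalabanLadder.UV`, NOT the Yang–Mills mass gap
(Clay); nothing about ℝ⁴ ∕ OS.  No decl below carries a cite tag.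
-/

set_option autoImplicit false

noncomputable section

open scoped BigOperators ENNReal
open MeasureTheory Set Function Metric Matrix Finset
open Complex (I)

namespace Summit.QuantumFields.YangMills.Theorems.N21ExpChartSharpRadiusHaar

open Literature.MathematicalPhysics.QuantumFieldTheory.Balaban1983to89
open Summit.QuantumFields.BalabanUV.T4Continuum
open Summit.QuantumFields.BalabanUV.T4Continuum.ShellMeasureExpChartSUN
  (SUN ChartSU genSU expPtSU coe_expPtSU expFibreChartSU BlockChartSU)
open Summit.QuantumFields.BalabanUV.T4Continuum.ShellMeasureVandermondeSUN (conjDiag)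
open Summit.QuantumFields.BalabanUV.T4Continuum.ShellMeasureExpJacobianSUN (herm exists_conjDiag norm_sq_eq_sum_sq)
open Summit.QuantumFields.BalabanUV.T4Continuum.ShellMeasureScalingSUN (expBallSU expWindowSU measurableSet_expBallSU)
open Summit.QuantumFields.YangMills.Theorems.N21ExpChartSharpRadius
  (abs_sub_eigen_lt_two_pi_of_norm_lt abs_sub_eigen_le_two_pi_of_norm_le sq_lt_two_mul_pi_sq_of_lt sq_add_sq_le_sum_sq
    exists_real_eigen_of_exp_eq_conjDiag injOn_expM_of_lt injective_fderiv_expM_of_norm_lt)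

variable {N : ℕ}

/-! ## §6 The area formula and (CH)₁ on every window `S < √2·π` -/

section Area

open scoped Matrix.Norms.Frobenius
open ShellMeasureExpChartSUN (dimSU measurable_expPtSU)
open ShellMeasureHaarHausdorffSUN
  (MatC expM hsInnerProductSpace image_expM hausdorff_image_val hausdorffSU haar_eq_smul_hausdorffSU continuous_expM)
open ShellMeasureExpHaarAreaSUN
  (jacM measurable_jacM hasFDerivAt_expM fderiv_expM measurableEmbedding_val kappaSU jacM_ae_eq_expJacSU)
open ShellMeasureExpJacobianSUN (expJacWeightSU)

/-- the area formula for the ambient chart on `B̄_S`, `S < √2·π` (the tree's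
`Literature.Analysis.Calculus.map_withDensity_normDet_eq_euclideanHausdorffMeasure` with §4's injectivity and §5's injective
differential; tree: `map_expM_withDensity_jacM_le`, `S ≤ π`). [folklore] -/
theorem map_expM_withDensity_jacM_of_lt {S : ℝ} (hS : S < Real.sqrt 2 * Real.pi) :
    Measure.map (expM (N := N)) (((volume : Measure (ChartSU N)).restrict (closedBall 0 S)).withDensity jacM) =
      (μHE[dimSU N] : Measure (MatC N)).restrict (expM '' closedBall (0 : ChartSU N) S) := by
  letI : InnerProductSpace ℝ (MatC N) := hsInnerProductSpace
  have h := Literature.Analysis.Calculus.map_withDensity_normDet_eq_euclideanHausdorffMeasure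
    (s := closedBall (0 : ChartSU N) S) (f := expM (N := N)) (f' := fun v => fderiv ℝ (expM (N := N)) v)
    measurableSet_closedBall (fun v _ => (hasFDerivAt_expM v).hasFDerivWithinAt.congr_fderiv (fderiv_expM v).symm)
    (fun v hv => injective_fderiv_expM_of_norm_lt ((mem_closedBall_zero_iff.mp hv).trans_lt hS)) (injOn_expM_of_lt hS)
    continuous_expM.measurable
  rw [finrank_euclideanSpace_fin] at h
  exact h

/-- the area formula on the group for `S < √2·π`. [folklore] -/
theorem map_expPtSU_withDensity_jacM_of_lt {S : ℝ} (hS : S < Real.sqrt 2 * Real.pi) :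
    Measure.map (expPtSU (N := N)) (((volume : Measure (ChartSU N)).restrict (closedBall 0 S)).withDensity jacM) =
      (hausdorffSU N).restrict (expBallSU S) := by
  have hval := measurableEmbedding_val (N := N)
  ext t ht
  have hpre : expPtSU ⁻¹' t = expM (N := N) ⁻¹' (Subtype.val '' t) := by
    rw [show expM (N := N) = Subtype.val ∘ expPtSU from rfl, preimage_comp,
      preimage_image_eq _ Subtype.val_injective]
  rw [Measure.map_apply measurable_expPtSU ht, hpre,
    ← Measure.map_apply continuous_expM.measurable (hval.measurableSet_image.mpr ht), map_expM_withDensity_jacM_of_lt hS,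
    Measure.restrict_apply (hval.measurableSet_image.mpr ht), Measure.restrict_apply ht, image_expM,
    ← image_inter Subtype.val_injective, hausdorff_image_val]
  rfl

variable [NeZero N]

/-- ★★ **(CH)₁ FOR `SU(N)` ON EVERY WINDOW `S < √2·π`**: for every `N ≥ 1`,
`Haar_{SU(N)} ⌞ expBallSU S = expPtSU_* (vol ⌞ B̄_S · expJacWeightSU κ_N)` — pub-balaban's binder `hCH` TOKEN-FOR-TOKEN with
`κ := kappaSU N` (tree: `haar_restrict_expBallSU_le`, `S ≤ π`, and `ShellMeasureExpHaarSU2.hCH_two_of_lt`, `S < √2·π` at `N = 2` only). [folklore] -/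
theorem haar_restrict_expBallSU_of_lt {S : ℝ} (hS : S < Real.sqrt 2 * Real.pi) :
    (HaarData.haar : Measure (SUN N)).restrict (expBallSU S) =
      (((volume : Measure (ChartSU N)).restrict (closedBall 0 S)).withDensity (expJacWeightSU (kappaSU N))).map
        expPtSU := by
  have hsmul : (fun v => kappaSU N * jacM (N := N) v) = kappaSU N • jacM := rfl
  have h1 : (HaarData.haar : Measure (SUN N)).restrict (expBallSU S) =
      Measure.map expPtSU (((volume : Measure (ChartSU N)).restrict (closedBall 0 S)).withDensity
        fun v => kappaSU N * jacM v) := by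
    rw [hsmul, withDensity_smul _ measurable_jacM, Measure.map_smul, map_expPtSU_withDensity_jacM_of_lt hS,
      haar_eq_smul_hausdorffSU, Measure.restrict_smul]
    rfl
  rw [h1]
  congr 1
  refine withDensity_congr_ae ?_
  filter_upwards [ae_restrict_of_ae (jacM_ae_eq_expJacSU (N := N))] with v hv
  rw [hv, expJacWeightSU]

end Area

/-! ## §7 Centre-monotonicity of the Haar Jacobian on the closed `√2·π`-ball -/

section Monotone

open ShellMeasureExpJacobianSUN
  (expJacSU expJacWeightSU expJacSU_eq_zero expJacSU_nonneg expJacSU_eq_prod_sinc herm_smul_eq_conjDiag prod_sub_smul_ne_zero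
    sinc_sq_half_le_smul)

/-- **CENTRE-MONOTONICITY OF THE EXPONENTIAL HAAR JACOBIAN FOR `‖v‖_HS ≤ √2·π`**: `expJacSU v ≤ expJacSU (c • v)` for
`0 < c ≤ 1` (pub-balaban's `expJacSU_le_smul`, `‖v‖ ≤ π`, VERBATIM with §1's gap bound `|θ_j − θ_i| ≤ 2π` — which is all that
`sinc_sq_half_le_smul` consumes).  Beyond `√2·π` it fails (`sinc²` vanishes at the gap `2π` and grows again after it). [folklore] -/
theorem expJacSU_le_smul_of_norm_le {v : ChartSU N} (hv : ‖v‖ ≤ Real.sqrt 2 * Real.pi) {c : ℝ} (hc0 : 0 < c) (hc1 : c ≤ 1) :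
    expJacSU v ≤ expJacSU (c • v) := by
  obtain ⟨U, θ, h⟩ := exists_conjDiag v
  have hc := herm_smul_eq_conjDiag h c
  by_cases hreg : ∏ i : Fin N, ∏ j ∈ Ioi i, (θ j - θ i) = 0
  · rw [expJacSU_eq_zero h hreg]
    exact expJacSU_nonneg _
  · rw [expJacSU_eq_prod_sinc h hreg, expJacSU_eq_prod_sinc hc (prod_sub_smul_ne_zero hreg hc0.ne')]
    refine prod_le_prod (fun i _ => prod_nonneg fun j _ => sq_nonneg _) fun i _ => ?_
    refine prod_le_prod (fun j _ => sq_nonneg _) fun j _ => ?_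
    rw [← mul_sub, mul_div_assoc, ← mul_div_assoc]
    exact sinc_sq_half_le_smul (abs_sub_eigen_le_two_pi_of_norm_le h hv i j) hc0 hc1

/-- `J₁ = κ · expJacSU` does not decrease towards the centre on every ball of radius `S ≤ √2·π` — LITERALLY the binder `hJ₁c` of
`ShellMeasureScalingSUN.slotAntiConcentration_realized_suN_of_coreMap` (tree: `expJacWeightSU_le_smul`, `S ≤ π`). [folklore] -/
theorem expJacWeightSU_le_smul_of_le (κ : ℝ≥0∞) {S : ℝ} (hS : S ≤ Real.sqrt 2 * Real.pi) :
    ∀ v : ChartSU N, ‖v‖ ≤ S → ∀ c : ℝ, 0 < c → c ≤ 1 → expJacWeightSU κ v ≤ expJacWeightSU κ (c • v) :=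
  fun _ hv _ hc0 hc1 =>
    mul_le_mul' le_rfl (ENNReal.ofReal_le_ofReal (expJacSU_le_smul_of_norm_le (hv.trans hS) hc0 hc1))

end Monotone

/-! ## §8 The `SU(N)` realized (M1) engine on the window range `0 ≤ S < √2·π` -/

section Engine

open ShellMeasureExpJacobianSUN (expJacWeightSU measurable_expJacWeightSU)
open ShellMeasureExpHaarAreaSUN (kappaSU)
open ShellMeasureScalingSUN (windowSU slotAntiConcentration_realized_suN_of_coreMap)

variable [NeZero N]

/-- ★★ **THE `SU(N)` REALIZED (M1) ENGINE WITH (CH)₁ SUPPLIED, WINDOW RANGE `0 ≤ S < √2·π`**: EXACTLY pub-balaban's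
`ShellMeasureExpHaarClosedBallSUN.slotAntiConcentration_realized_suN_le` (`S ≤ π`) with the radius bound relaxed to `S < √2·π` —
every other binder verbatim ((S-i) `hcore`, (S-ii) `hden`, window factorisation `hFw`, per-section finiteness `hfin`). [folklore] -/
theorem slotAntiConcentration_realized_suN_of_lt {P : Params} {j : ℕ} [DecidableEq (PBond P j)]
    (Λ : Finset (PBond P j)) {S : ℝ} (hS : 0 ≤ S) (hS2 : S < Real.sqrt 2 * Real.pi)
    (c : GaugeField P j (SUN N) → GaugeField P j (SUN N))
    {R : GaugeField P j (SUN N) → (↥Λ → SUN N) → ℝ≥0∞} (hR : ∀ V, Measurable (R V))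
    {F : GaugeField P j (SUN N) → ℝ≥0∞} (hF : Measurable F)
    (hFw : ∀ V y, F (updateFinset V Λ y) = windowSU Λ (c V) S y * R V y)
    (hfin : ∀ V, ((T4ShellMeasureDet.blockLaw Λ).withDensity fun y => F (updateFinset V Λ y)) univ ≠ ∞)
    {u : GaugeField P j (SUN N) → ℝ} (hu : Measurable u) {θ ρ a Bf D : ℝ} (hθ : 0 ≤ θ) (hρ : 0 ≤ ρ) (ha : 0 ≤ a)
    (haD : ((Λ.card * ShellMeasureExpChartSUN.dimSU N : ℕ) + Bf) * a ≤ D * ρ)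
    (hcore : ∀ V x, x ∈ closedBall (0 : BlockChartSU N Λ) S → R V (expFibreChartSU Λ (c V) x) ≠ 0 →
      u (updateFinset V Λ (expFibreChartSU Λ (c V) x)) < θ →
      u (updateFinset V Λ (expFibreChartSU Λ (c V) (Real.exp (-a) • x))) < θ * (1 - ρ))
    (hden : ∀ V x, x ∈ closedBall (0 : BlockChartSU N Λ) S → R V (expFibreChartSU Λ (c V) x) ≠ 0 →
      u (updateFinset V Λ (expFibreChartSU Λ (c V) x)) < θ →
      R V (expFibreChartSU Λ (c V) x) ≤
        ENNReal.ofReal (Real.exp (Bf * a)) * R V (expFibreChartSU Λ (c V) (Real.exp (-a) • x))) :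
    T4ShellMeasure.SlotAntiConcentration ((fieldMeasure P j (SUN N)).withDensity F) u θ ρ D :=
  slotAntiConcentration_realized_suN_of_coreMap Λ hS (measurable_expJacWeightSU (kappaSU N))
    (expJacWeightSU_le_smul_of_le (kappaSU N) hS2.le) (haar_restrict_expBallSU_of_lt hS2) c hR hF hFw hfin hu hθ hρ ha haD
    hcore hden

end Engine

/-! ## §9 Properness of the window for every `S < √2·π`, `N ≥ 2` -/

section Proper

open Summit.QuantumFields.YangMills.Theorems.N21ExpWindowHaarMassLtOne
  (isCompact_expBallSU haar_isOpenPosMeasure haar_expWindowSU_eq)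
open ShellMeasureScalingSUN (measurableSet_expWindowSU)

/-- `e^{ia} = −1 ⇒ π ≤ |a|` (`a ∈ π + 2πℤ`). [folklore] -/
theorem pi_le_abs_of_cexp_mul_I_eq_neg_one {a : ℝ} (h : Complex.exp (a * I) = -1) : Real.pi ≤ |a| := by
  rw [← Complex.exp_pi_mul_I] at h
  obtain ⟨n, hn⟩ := Complex.exp_eq_exp_iff_exists_int.mp h
  have ha : a = Real.pi + n * (2 * Real.pi) := by
    have := congrArg Complex.im hn
    simpa using this
  have hodd : (1 : ℝ) ≤ |(2 * n + 1 : ℝ)| := by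
    have h1 : (1 : ℤ) ≤ |2 * n + 1| := Int.one_le_abs (by omega)
    have h2 : ((1 : ℤ) : ℝ) ≤ ((|2 * n + 1| : ℤ) : ℝ) := Int.cast_le.mpr h1
    rw [Int.cast_abs] at h2
    exact_mod_cast h2
  calc Real.pi = Real.pi * 1 := (mul_one _).symm
    _ ≤ Real.pi * |(2 * n + 1 : ℝ)| := by gcongr
    _ = |a| := by rw [ha, ← abs_of_pos Real.pi_pos, ← abs_mul, abs_of_pos Real.pi_pos]; ring_nf

/-- `(1 : U(N))` conjugates the diagonal to itself: `conjDiag 1 d = diagonal d`. [folklore] -/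
theorem conjDiag_one_left (d : Fin N → ℂ) : conjDiag (1 : Matrix.unitaryGroup (Fin N) ℂ) d = diagonal d := by
  unfold conjDiag
  rw [OneMemClass.coe_one, star_one, Matrix.one_mul, Matrix.mul_one]

/-- ★ **`diag(−1, −1, 1, …, 1) ∉ exp B̄_S` FOR EVERY `S < √2·π` (`N ≥ 2`)**: by §4 a preimage `v` with `‖v‖ < √2·π` would have
`H(v)` diagonal with real angles `α`, `e^{iα_k} = ∓1`, so two angles have `|α_k| ≥ π` and `‖v‖² = Σα² ≥ 2π²`.  File 18's witness
(`exists_not_mem_expBallSU`, `S ≤ π`) on the full range; at `S = √2·π` it IS in the window (`θ = (π, −π, 0, …)`). [folklore] -/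
theorem exists_not_mem_expBallSU_of_lt (hN : 2 ≤ N) {S : ℝ} (hS : S < Real.sqrt 2 * Real.pi) :
    ∃ U : SUN N, U ∉ expBallSU S := by
  let i₀ : Fin N := ⟨0, by omega⟩
  let i₁ : Fin N := ⟨1, by omega⟩
  have hne : i₀ ≠ i₁ := fun h => by
    have := congrArg Fin.val h
    simp [i₀, i₁] at this
  let d : Fin N → ℂ := fun i => if i = i₀ ∨ i = i₁ then -1 else 1
  have hd : ∀ i, d i = -1 ∨ d i = 1 := fun i => by
    by_cases hi : i = i₀ ∨ i = i₁
    · exact Or.inl (if_pos hi)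
    · exact Or.inr (if_neg hi)
  have hd₀ : d i₀ = -1 := if_pos (Or.inl rfl)
  have hd₁ : d i₁ = -1 := if_pos (Or.inr rfl)
  -- unitary
  have hunit : diagonal d ∈ Matrix.unitaryGroup (Fin N) ℂ := by
    rw [Matrix.mem_unitaryGroup_iff, star_eq_conjTranspose, diagonal_conjTranspose, diagonal_mul_diagonal]
    have h1 : (fun i => d i * star (d i)) = fun _ => (1 : ℂ) := by
      funext i
      rcases hd i with h | h <;> simp [h]
    rw [show (fun i => d i * star d i) = fun i => d i * star (d i) from rfl, h1, diagonal_one]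
  -- determinant one
  have hdet : (diagonal d).det = 1 := by
    rw [det_diagonal, ← Finset.mul_prod_erase _ _ (Finset.mem_univ i₀),
      ← Finset.mul_prod_erase _ _ (Finset.mem_erase.mpr ⟨hne.symm, Finset.mem_univ i₁⟩),
      Finset.prod_eq_one (fun i hi => ?_), hd₀, hd₁]
    · norm_num
    · obtain ⟨hi1, hi⟩ := Finset.mem_erase.mp hi
      obtain ⟨hi0, _⟩ := Finset.mem_erase.mp hi
      exact if_neg (not_or.mpr ⟨hi0, hi1⟩)
  refine ⟨⟨diagonal d, Matrix.mem_specialUnitaryGroup_iff.mpr ⟨hunit, hdet⟩⟩, ?_⟩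
  rintro ⟨v, hv, hvU⟩
  have hvlt : ‖v‖ < Real.sqrt 2 * Real.pi := (mem_closedBall_zero_iff.mp hv).trans_lt hS
  have hmat : NormedSpace.exp (genSU v) = conjDiag 1 d := by
    rw [conjDiag_one_left, ← coe_expPtSU, hvU]
  obtain ⟨α, hα, hexp⟩ := exists_real_eigen_of_exp_eq_conjDiag hvlt hmat
  have hπ₀ : Real.pi ≤ |α i₀| := pi_le_abs_of_cexp_mul_I_eq_neg_one (by rw [hexp i₀, hd₀])
  have hπ₁ : Real.pi ≤ |α i₁| := pi_le_abs_of_cexp_mul_I_eq_neg_one (by rw [hexp i₁, hd₁])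
  have hsq₀ : Real.pi ^ 2 ≤ α i₀ ^ 2 := by rw [← sq_abs (α i₀)]; gcongr
  have hsq₁ : Real.pi ^ 2 ≤ α i₁ ^ 2 := by rw [← sq_abs (α i₁)]; gcongr
  have hsum : ∑ k, α k ^ 2 < 2 * Real.pi ^ 2 :=
    (norm_sq_eq_sum_sq hα).symm.trans_lt (sq_lt_two_mul_pi_sq_of_lt (norm_nonneg v) hvlt)
  have h2 := sq_add_sq_le_sum_sq α hne
  linarith

/-- … and outside every WINDOW `g · expBallSU S` (`S < √2·π`, `N ≥ 2`). [folklore] -/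
theorem exists_not_mem_expWindowSU_of_lt (hN : 2 ≤ N) (g : SUN N) {S : ℝ} (hS : S < Real.sqrt 2 * Real.pi) :
    ∃ U : SUN N, U ∉ expWindowSU g S := by
  obtain ⟨U, hU⟩ := exists_not_mem_expBallSU_of_lt hN hS
  refine ⟨g * U, fun h => hU ?_⟩
  obtain ⟨W, hW, hgW⟩ := h
  rwa [← mul_left_cancel hgW]

variable [NeZero N]

/-- the complement of the exponential image ball has POSITIVE Haar mass (`N ≥ 2`, `S < √2·π`). [folklore] -/
theorem haar_compl_expBallSU_pos_of_lt (hN : 2 ≤ N) {S : ℝ} (hS : S < Real.sqrt 2 * Real.pi) :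
    0 < (HaarData.haar : Measure (SUN N)) (expBallSU S)ᶜ := by
  haveI := haar_isOpenPosMeasure (N := N)
  obtain ⟨U, hU⟩ := exists_not_mem_expBallSU_of_lt (N := N) hN hS
  exact (isCompact_expBallSU S).isClosed.isOpen_compl.measure_pos _ ⟨U, hU⟩

/-- ★ **THE EXPONENTIAL WINDOW HAS HAAR MASS `< 1` FOR EVERY `S < √2·π`** (`N ≥ 2`) — file 18's `haar_expBallSU_lt_one` (`S ≤ π`)
on the full range.  (At `N = 2`, `S = √2·π` the window is all of `SU(2)`, so the range is sharp there.) [folklore] -/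
theorem haar_expBallSU_lt_one_of_lt (hN : 2 ≤ N) {S : ℝ} (hS : S < Real.sqrt 2 * Real.pi) :
    (HaarData.haar : Measure (SUN N)) (expBallSU S) < 1 := by
  haveI : IsProbabilityMeasure (HaarData.haar : Measure (SUN N)) := HaarData.isProb
  have hadd : (HaarData.haar : Measure (SUN N)) (expBallSU S) + (HaarData.haar : Measure (SUN N)) (expBallSU S)ᶜ = 1 := by
    rw [measure_add_measure_compl (measurableSet_expBallSU S), measure_univ]
  calc (HaarData.haar : Measure (SUN N)) (expBallSU S)
      < (HaarData.haar : Measure (SUN N)) (expBallSU S) + (HaarData.haar : Measure (SUN N)) (expBallSU S)ᶜ :=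
        ENNReal.lt_add_right (measure_ne_top _ _) (haar_compl_expBallSU_pos_of_lt hN hS).ne'
    _ = 1 := hadd

/-- ★ **EVERY WINDOW `g · exp B̄_S` HAS HAAR MASS `< 1`** (`N ≥ 2`, `S < √2·π`) — the letter `hq` of dag-n21-w2's LOCATED-1 certificate
on the full radius range. [folklore] -/
theorem haar_expWindowSU_lt_one_of_lt (hN : 2 ≤ N) (g : SUN N) {S : ℝ} (hS : S < Real.sqrt 2 * Real.pi) :
    (HaarData.haar : Measure (SUN N)) (expWindowSU g S) < 1 := by
  rw [haar_expWindowSU_eq]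
  exact haar_expBallSU_lt_one_of_lt hN hS

/-- the complement of every window has positive Haar mass (`N ≥ 2`, `S < √2·π`). [folklore] -/
theorem haar_compl_expWindowSU_pos_of_lt (hN : 2 ≤ N) (g : SUN N) {S : ℝ} (hS : S < Real.sqrt 2 * Real.pi) :
    0 < (HaarData.haar : Measure (SUN N)) (expWindowSU g S)ᶜ := by
  haveI : IsProbabilityMeasure (HaarData.haar : Measure (SUN N)) := HaarData.isProb
  rw [prob_compl_eq_one_sub (measurableSet_expWindowSU g S)]
  exact tsub_pos_of_lt (haar_expWindowSU_lt_one_of_lt hN g hS)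

end Proper

/-! ## §10 A2: at `N = 2` the CLOSED `√2·π`-window is all of `SU(2)` — §9's range `S < √2·π` is sharp -/

section RankTwo

open Summit.QuantumFields.BalabanUV.T4Continuum.UnitaryResolventMargin (exists_conjDiag_of_unitary)
open Summit.QuantumFields.BalabanUV.T4Continuum.ShellMeasureExpJacobianSUN (exp_genSU_eq_conjDiag)
open Summit.QuantumFields.YangMills.Theorems.N21ExpWindowHaarMassLtOne (det_conjDiag)
open Summit.QuantumFields.YangMills.Theorems.N21ExpChartSurjective (cexp_arg_mul_I_of_norm_eq_one exists_herm_eq_conjDiag)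

/-- **EVERY ELEMENT OF `SU(2)` IS A CHART POINT OF HILBERT–SCHMIDT NORM `≤ √2·π`**: diagonalise `U = V·diag(λ₀, λ₁)·V*`,
`λ₀λ₁ = 1`, and take the angles `(−t, t)`, `t = arg λ₁ ∈ (−π, π]` (file 19's `exists_expPtSU_eq` gives `3√2·π` at `N = 2`; the
trace-free correction costs nothing in rank two). [folklore] -/
theorem exists_expPtSU_eq_of_rank_two (U : SUN 2) :
    ∃ v : ChartSU 2, expPtSU v = U ∧ ‖v‖ ≤ Real.sqrt 2 * Real.pi := by
  obtain ⟨V, lam, hlam, hW0⟩ := exists_conjDiag_of_unitary (Matrix.mem_specialUnitaryGroup_iff.mp U.2).1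
  have hW : (U : Matrix (Fin 2) (Fin 2) ℂ) = conjDiag V lam := hW0
  have hdet : (U : Matrix (Fin 2) (Fin 2) ℂ).det = 1 := (Matrix.mem_specialUnitaryGroup_iff.mp U.2).2
  rw [hW, det_conjDiag, Fin.prod_univ_two] at hdet
  set t : ℝ := Complex.arg (lam 1) with htdef
  have ht : Complex.exp (t * I) = lam 1 := cexp_arg_mul_I_of_norm_eq_one (hlam 1)
  have htπ : |t| ≤ Real.pi := Complex.abs_arg_le_pi _
  let θ : Fin 2 → ℝ := ![-t, t]
  have hθ0 : θ 0 = -t := rfl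
  have hθ1 : θ 1 = t := rfl
  have hsum0 : ∑ j, θ j = 0 := by rw [Fin.sum_univ_two, hθ0, hθ1, neg_add_cancel]
  have hθlam : ∀ j, Complex.exp (θ j * I) = lam j := by
    intro j
    fin_cases j
    · show Complex.exp (θ 0 * I) = lam 0
      rw [hθ0, Complex.ofReal_neg, neg_mul, Complex.exp_neg, ht]
      exact inv_eq_of_mul_eq_one_left hdet
    · show Complex.exp (θ 1 * I) = lam 1
      rw [hθ1, ht]
  obtain ⟨v, hherm⟩ := exists_herm_eq_conjDiag V θ hsum0
  refine ⟨v, ?_, ?_⟩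
  · apply Subtype.ext
    rw [coe_expPtSU, exp_genSU_eq_conjDiag hherm, hW]
    congr 1
    funext j
    exact hθlam j
  · have hsq : ‖v‖ ^ 2 = 2 * t ^ 2 := by
      rw [norm_sq_eq_sum_sq hherm, Fin.sum_univ_two, hθ0, hθ1]; ring
    have ht2 : t ^ 2 ≤ Real.pi ^ 2 := by
      rw [← sq_abs t]
      exact pow_le_pow_left₀ (abs_nonneg t) htπ 2
    have h0 : 0 ≤ Real.sqrt 2 * Real.pi := by positivity
    refine (pow_le_pow_iff_left₀ (norm_nonneg v) h0 two_ne_zero).mp ?_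
    rw [hsq, mul_pow, Real.sq_sqrt zero_le_two]
    linarith

/-- **AT `N = 2` THE CLOSED `√2·π`-WINDOW IS THE WHOLE GROUP**: `expBallSU (√2·π) = SU(2)` — so §9's properness `Haar (exp B̄_S) < 1`
for every `S < √2·π` cannot reach `S = √2·π`, and with file 19's A2 both halves of the radius `√2·π` are sharp already in rank two. [folklore] -/
theorem expBallSU_rank_two_sqrt_two_mul_pi_eq_univ : expBallSU (N := 2) (Real.sqrt 2 * Real.pi) = univ :=
  eq_univ_of_forall fun U => by
    obtain ⟨v, hv, hle⟩ := exists_expPtSU_eq_of_rank_two U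
    exact ⟨v, mem_closedBall_zero_iff.mpr hle, hv⟩

/-- … hence Haar mass `1` (contrast §9: `< 1` for every `S < √2·π`). [folklore] -/
theorem haar_expBallSU_rank_two_sqrt_two_mul_pi :
    (HaarData.haar : Measure (SUN 2)) (expBallSU (Real.sqrt 2 * Real.pi)) = 1 := by
  haveI : IsProbabilityMeasure (HaarData.haar : Measure (SUN 2)) := HaarData.isProb
  rw [expBallSU_rank_two_sqrt_two_mul_pi_eq_univ, measure_univ]

end RankTwo

end Summit.QuantumFields.YangMills.Theorems.N21ExpChartSharpRadiusHaar

end
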